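import Literature.MathematicalPhysics.QuantumFieldTheory.YangMillsOS

/-!
# Crux `LatticeGapLargeBeta` (route `EquipartitionCriticality`), line `Sketch` = card
`af-staircase-transport`: stub `stub_iterateLadder` — climbing the ladder, then the free staircase

Supports statement item stmt-QuantumFields-8761
(`Summit.QuantumFields.YangMills.Theses.EquipartitionCriticality.LatticeGapLargeBeta`), line
`Sketch` (asymptotic-freedom staircase), stub I′ = `stub_iterateLadder` of the lead's registered
skeleton (reshape r1; it supersedes the r0 stub `stub_iterate`, whose architecture is copied here).

Content.  In the currency of the line,

  SC(β, S, m, K) :≡ for all species `A, B` with sup bounds `a, b` and supports in the time slab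
    `|t| ≤ w`, and all `n ≤ S`:
    `|latticeConnectedCorr r.ρ β (2S+1) A.F B.F n| ≤ K a b e^{2mw} e^{−mn}`,

the stub says: the LADDERED staircase (there are `Δβ > 0`, `θ ∈ (0, 1]`, `c ≥ 1`, `L₀`, a threshold
`β⋆`, and a ladder `0 = lad 0 < lad 1 < ⋯` with rungs of height `≤ Δβ` reaching `β⋆`, such that for
all `β ≥ 0`, `0 < δ ≤ Δβ` with landing point `β + δ` either `≥ β⋆` or a ladder point, all
`S ≥ L₀ β`, `0 < m ≤ 1`, `K ≥ 2`: SC(β, S, m, K) ⇒ SC(β+δ, 2S, θm, cK) ∧ SC(β+δ, 2S+1, θm, cK))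
together with the anchor SC(0, S, 1, 2) for every `S` give a threshold `β₁` such that for every
`β ≥ β₁` there are `m ∈ (0, 1]`, `K ≥ 2`, `S₀` with SC(β, S, m, K) for all `S ≥ S₀`.

This is pure logic plus elementary real arithmetic: nothing about the Wilson measure is used.  It
is first proved for an ARBITRARY predicate `P : ℝ → ℕ → ℝ → ℝ → Prop`:
* `ladder_climb`: `P` at every ladder point `lad k` on all large tori, by induction on `k` (rung from
  `lad k` with `δ = lad (k+1) − lad k ∈ (0, Δβ]`, landing point the ladder point `lad (k+1)`;
  half-side `T`, `S = 2T` or `S = 2T+1`, for `S ≥ 2 (S₀ + L₀ (lad k))`; rate `θ m`, prefactor `c K`);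
* `free_climb_le` / `free_climb`: with `β₁ := lad k₀ ≥ β⋆`, by induction on `j` for
  `β₁ ≤ β ≤ β₁ + j Δβ`: apply the rung at `β' = β₁ + (β − β₁) j/(j+1) ∈ [β₁, β₁ + j Δβ]` with
  `δ = (β − β₁)/(j+1) ∈ (0, Δβ]`, landing point `β ≥ β₁ ≥ β⋆`; then `j := ⌈(β − β₁)/Δβ⌉₊`.
Finally `P` is instantiated with the SC block (`stub_iterateLadder`, `β₁ := lad k₀`).

Not here: the staircase itself (the heart of the line), the anchor at `β = 0`, rate dilution, the
passage to the crux body — these are the other stubs of the skeleton.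
-/

noncomputable section

open scoped BigOperators Topology
open MeasureTheory ProbabilityTheory Filter
open Literature.MathematicalPhysics.QuantumFieldTheory Literature.MathematicalPhysics.QuantumLattice

namespace Summit.QuantumFields.YangMills.Theorems.LatticeGapLargeBeta.AfStaircase

/-- A ladder starting at `0` with increasing rungs is nonnegative everywhere. [folklore] -/
private theorem ladder_nonneg {lad : ℕ → ℝ} {Δβ : ℝ} (h0 : lad 0 = 0)
    (hlad : ∀ k : ℕ, lad k < lad (k + 1) ∧ lad (k + 1) ≤ lad k + Δβ) :
    ∀ k : ℕ, 0 ≤ lad k := by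
  intro k
  induction k with
  | zero => exact h0.ge
  | succ k ih => exact ih.trans (hlad k).1.le

/-- **Abstract ladder climb.**  For an arbitrary predicate `P β S m K` ("clustering at coupling `β`
on the torus of half-side `S` with rate `m` and prefactor `K`"): if one rung raises the coupling by
any `δ ∈ (0, Δβ]` whose landing point `β + δ` is `≥ βs` or a ladder point, while doubling the
half-side (to `2S` and to `2S+1`) at the cost `m ↦ θ m`, `K ↦ c K` (`0 < θ ≤ 1 ≤ c`), for
`S ≥ L₀ β`, `0 < m ≤ 1`, `K ≥ 2`, and if `P 0 S 1 2` holds for every `S`, then at every ladder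
point `lad k` (`lad 0 = 0`, `lad k < lad (k+1) ≤ lad k + Δβ`) there are `m ∈ (0, 1]`, `K ≥ 2`,
`S₀` with `P (lad k) S m K` for all `S ≥ S₀`.  Induction on `k`; the rung from `lad k` has
`δ = lad (k+1) − lad k` and halves the side. [folklore] -/
private theorem ladder_climb {P : ℝ → ℕ → ℝ → ℝ → Prop} {Δβ θ c βs : ℝ} {L₀ : ℝ → ℕ}
    {lad : ℕ → ℝ} (hθ : 0 < θ) (hθ1 : θ ≤ 1) (hc : 1 ≤ c) (h0 : lad 0 = 0)
    (hlad : ∀ k : ℕ, lad k < lad (k + 1) ∧ lad (k + 1) ≤ lad k + Δβ)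
    (hstep : ∀ β : ℝ, 0 ≤ β → ∀ δ : ℝ, 0 < δ → δ ≤ Δβ → (βs ≤ β + δ ∨ ∃ k : ℕ, β + δ = lad k) →
      ∀ S : ℕ, L₀ β ≤ S → ∀ m K : ℝ, 0 < m → m ≤ 1 → 2 ≤ K → P β S m K →
        P (β + δ) (2 * S) (θ * m) (c * K) ∧ P (β + δ) (2 * S + 1) (θ * m) (c * K))
    (hanch : ∀ S : ℕ, P 0 S 1 2) :
    ∀ k : ℕ, ∃ (m K : ℝ) (S₀ : ℕ), 0 < m ∧ m ≤ 1 ∧ 2 ≤ K ∧ ∀ S : ℕ, S₀ ≤ S → P (lad k) S m K := by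
  intro k
  induction k with
  | zero =>
    rw [h0]
    exact ⟨1, 2, 0, one_pos, le_rfl, le_rfl, fun S _ => hanch S⟩
  | succ k ih =>
    obtain ⟨m', K', S₀', hm', hm'1, hK', hP⟩ := ih
    have hβ0 : 0 ≤ lad k := ladder_nonneg h0 hlad k
    have hδ0 : 0 < lad (k + 1) - lad k := sub_pos.2 (hlad k).1
    have hδ : lad (k + 1) - lad k ≤ Δβ := by linarith [(hlad k).2]
    have e : lad k + (lad (k + 1) - lad k) = lad (k + 1) := by ring
    have hland : βs ≤ lad k + (lad (k + 1) - lad k) ∨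
        ∃ j : ℕ, lad k + (lad (k + 1) - lad k) = lad j := Or.inr ⟨k + 1, e⟩
    refine ⟨θ * m', c * K', 2 * (S₀' + L₀ (lad k)), mul_pos hθ hm', mul_le_one₀ hθ1 hm'.le hm'1,
      hK'.trans (le_mul_of_one_le_left (zero_le_two.trans hK') hc), fun S hS => ?_⟩
    -- halve the side: `S = 2T` or `S = 2T + 1` with `T ≥ S₀'` and `T ≥ L₀ (lad k)`
    obtain ⟨T, rfl | rfl⟩ := Nat.even_or_odd' S
    · have h := (hstep (lad k) hβ0 _ hδ0 hδ hland T (by omega) m' K' hm' hm'1 hK'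
        (hP T (by omega))).1
      rwa [e] at h
    · have h := (hstep (lad k) hβ0 _ hδ0 hδ hland T (by omega) m' K' hm' hm'1 hK'
        (hP T (by omega))).2
      rwa [e] at h

/-- **Abstract free climb above the ladder, bounded number of steps.**  As `ladder_climb`; moreover,
if the ladder reaches the threshold (`βs ≤ lad k₀`), then for every `j : ℕ` and every
`β ∈ [lad k₀, lad k₀ + j Δβ]` there are `m ∈ (0, 1]`, `K ≥ 2`, `S₀` with `P β S m K` for all
`S ≥ S₀`.  Induction on `j`; the step splits `β = β' + δ`, `β' = lad k₀ + (β − lad k₀) j/(j+1)`,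
`δ = (β − lad k₀)/(j+1)`, the landing point `β ≥ lad k₀ ≥ βs` being admissible, and halves the
side. [folklore] -/
private theorem free_climb_le {P : ℝ → ℕ → ℝ → ℝ → Prop} {Δβ θ c βs : ℝ} {L₀ : ℝ → ℕ}
    {lad : ℕ → ℝ} {k₀ : ℕ} (hθ : 0 < θ) (hθ1 : θ ≤ 1) (hc : 1 ≤ c) (h0 : lad 0 = 0)
    (hlad : ∀ k : ℕ, lad k < lad (k + 1) ∧ lad (k + 1) ≤ lad k + Δβ)
    (hstep : ∀ β : ℝ, 0 ≤ β → ∀ δ : ℝ, 0 < δ → δ ≤ Δβ → (βs ≤ β + δ ∨ ∃ k : ℕ, β + δ = lad k) →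
      ∀ S : ℕ, L₀ β ≤ S → ∀ m K : ℝ, 0 < m → m ≤ 1 → 2 ≤ K → P β S m K →
        P (β + δ) (2 * S) (θ * m) (c * K) ∧ P (β + δ) (2 * S + 1) (θ * m) (c * K))
    (hanch : ∀ S : ℕ, P 0 S 1 2) (hk₀ : βs ≤ lad k₀) :
    ∀ (j : ℕ) (β : ℝ), lad k₀ ≤ β → β ≤ lad k₀ + j * Δβ →
      ∃ (m K : ℝ) (S₀ : ℕ), 0 < m ∧ m ≤ 1 ∧ 2 ≤ K ∧ ∀ S : ℕ, S₀ ≤ S → P β S m K := by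
  intro j
  induction j with
  | zero =>
    intro β hβ hβj
    obtain rfl : β = lad k₀ := le_antisymm (by simpa using hβj) hβ
    exact ladder_climb hθ hθ1 hc h0 hlad hstep hanch k₀
  | succ j ih =>
    intro β hβ hβj
    push_cast at hβj
    rcases hβ.eq_or_lt with rfl | hβpos
    · exact ladder_climb hθ hθ1 hc h0 hlad hstep hanch k₀
    have hj0 : (0 : ℝ) ≤ j := Nat.cast_nonneg j
    have hj1 : (0 : ℝ) < j + 1 := by positivity
    have hd : 0 < β - lad k₀ := sub_pos.2 hβpos
    have hdj : β - lad k₀ ≤ (j + 1) * Δβ := by linarith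
    -- split `β = β' + δ` with `β' = lad k₀ + (β - lad k₀) j/(j+1) ∈ [lad k₀, lad k₀ + j Δβ]` and
    -- `δ = (β - lad k₀)/(j+1) ∈ (0, Δβ]`
    obtain ⟨β', hβ'0, hβ'j, δ, hδ0, hδ, rfl⟩ :
        ∃ β' : ℝ, lad k₀ ≤ β' ∧ β' ≤ lad k₀ + j * Δβ ∧
          ∃ δ : ℝ, 0 < δ ∧ δ ≤ Δβ ∧ β' + δ = β := by
      refine ⟨lad k₀ + (β - lad k₀) * j / (j + 1), ?_, ?_, (β - lad k₀) / (j + 1),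
        div_pos hd hj1, ?_, ?_⟩
      · have : 0 ≤ (β - lad k₀) * j / (j + 1) := div_nonneg (mul_nonneg hd.le hj0) hj1.le
        linarith
      · have : (β - lad k₀) * j / (j + 1) ≤ j * Δβ := by
          rw [div_le_iff₀ hj1]
          calc (β - lad k₀) * j ≤ (j + 1) * Δβ * j := mul_le_mul_of_nonneg_right hdj hj0
            _ = j * Δβ * (j + 1) := by ring
        linarith
      · rw [div_le_iff₀ hj1]
        linarith
      · have : (β - lad k₀) * j / (j + 1) + (β - lad k₀) / (j + 1) = β - lad k₀ := by
          rw [← add_div, div_eq_iff hj1.ne']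
          ring
        linarith
    obtain ⟨m', K', S₀', hm', hm'1, hK', hP⟩ := ih β' hβ'0 hβ'j
    have hβ'nn : 0 ≤ β' := (ladder_nonneg h0 hlad k₀).trans hβ'0
    have hland : βs ≤ β' + δ ∨ ∃ k : ℕ, β' + δ = lad k := Or.inl (hk₀.trans hβ)
    refine ⟨θ * m', c * K', 2 * (S₀' + L₀ β'), mul_pos hθ hm', mul_le_one₀ hθ1 hm'.le hm'1,
      hK'.trans (le_mul_of_one_le_left (zero_le_two.trans hK') hc), fun S hS => ?_⟩
    -- halve the side: `S = 2T` or `S = 2T + 1` with `T ≥ S₀'` and `T ≥ L₀ β'`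
    obtain ⟨T, rfl | rfl⟩ := Nat.even_or_odd' S
    · exact (hstep β' hβ'nn δ hδ0 hδ hland T (by omega) m' K' hm' hm'1 hK' (hP T (by omega))).1
    · exact (hstep β' hβ'nn δ hδ0 hδ hland T (by omega) m' K' hm' hm'1 hK' (hP T (by omega))).2

/-- **Abstract free climb above the ladder.**  As `free_climb_le`, for every `β ≥ lad k₀`: take
`j = ⌈(β − lad k₀)/Δβ⌉₊` steps (`β − lad k₀ ≤ ⌈(β − lad k₀)/Δβ⌉₊ Δβ` as `Δβ > 0`). [folklore] -/
private theorem free_climb {P : ℝ → ℕ → ℝ → ℝ → Prop} {Δβ θ c βs : ℝ} {L₀ : ℝ → ℕ}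
    {lad : ℕ → ℝ} {k₀ : ℕ} (hΔ : 0 < Δβ) (hθ : 0 < θ) (hθ1 : θ ≤ 1) (hc : 1 ≤ c)
    (h0 : lad 0 = 0) (hlad : ∀ k : ℕ, lad k < lad (k + 1) ∧ lad (k + 1) ≤ lad k + Δβ)
    (hstep : ∀ β : ℝ, 0 ≤ β → ∀ δ : ℝ, 0 < δ → δ ≤ Δβ → (βs ≤ β + δ ∨ ∃ k : ℕ, β + δ = lad k) →
      ∀ S : ℕ, L₀ β ≤ S → ∀ m K : ℝ, 0 < m → m ≤ 1 → 2 ≤ K → P β S m K →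
        P (β + δ) (2 * S) (θ * m) (c * K) ∧ P (β + δ) (2 * S + 1) (θ * m) (c * K))
    (hanch : ∀ S : ℕ, P 0 S 1 2) (hk₀ : βs ≤ lad k₀) :
    ∀ β : ℝ, lad k₀ ≤ β →
      ∃ (m K : ℝ) (S₀ : ℕ), 0 < m ∧ m ≤ 1 ∧ 2 ≤ K ∧ ∀ S : ℕ, S₀ ≤ S → P β S m K :=
  fun β hβ => free_climb_le hθ hθ1 hc h0 hlad hstep hanch hk₀ ⌈(β - lad k₀) / Δβ⌉₊ β hβ
    (by linarith [(div_le_iff₀ hΔ).1 (Nat.le_ceil ((β - lad k₀) / Δβ))])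

/-- `stub_iterateLadder` — **climbing the ladder, then the free staircase** (stub I′ of line
`Sketch`, card `af-staircase-transport`, crux `LatticeGapLargeBeta`, reshape r1).  From the laddered
staircase (hypothesis, the shape of `stub_staircase`'s conclusion for `r`: there are `Δβ > 0`,
`θ ∈ (0, 1]`, `c ≥ 1`, a threshold `βs`, `L₀`, and a ladder `lad` with `lad 0 = 0`,
`lad k < lad (k+1) ≤ lad k + Δβ`, `βs ≤ lad k₀` for some `k₀`, such that for all `β ≥ 0`,
`0 < δ ≤ Δβ` with `βs ≤ β + δ` or `β + δ` a ladder point, `S ≥ L₀ β`, `0 < m ≤ 1`, `K ≥ 2`,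
SC(β, S, m, K) ⇒ SC(β+δ, 2S, θm, cK) ∧ SC(β+δ, 2S+1, θm, cK)) and the anchor SC(0, S, 1, 2) for all
`S` (the shape of `stub_anchorZero`'s conclusion for `r`): there is `β₁` such that for every
`β ≥ β₁` there are `m ∈ (0, 1]`, `K ≥ 2` and `S₀` with SC(β, S, m, K) for all `S ≥ S₀`.  Here
SC(β, S, m, K) is the inlined block "for all species `A, B` bounded by `a, b` with supports in the
time slab `|t| ≤ w` and all `n ≤ S`,
`|latticeConnectedCorr r.ρ β (2S+1) A.F B.F n| ≤ K a b e^{2mw} e^{−mn}`".  Proof: `free_climb`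
with `P β S m K :=` SC(β, S, m, K) and `β₁ := lad k₀`. [folklore] -/
theorem stub_iterateLadder :
    ∀ (G : Type) [Group G] [TopologicalSpace G] [IsTopologicalGroup G] [CompactSpace G]
      [MeasurableSpace G] [BorelSpace G] (r : LatticeRep G),
    (∃ (Δβ θ c βs : ℝ) (L₀ : ℝ → ℕ) (lad : ℕ → ℝ), 0 < Δβ ∧ 0 < θ ∧ θ ≤ 1 ∧ 1 ≤ c ∧
      lad 0 = 0 ∧ (∀ k : ℕ, lad k < lad (k + 1) ∧ lad (k + 1) ≤ lad k + Δβ) ∧ (∃ k : ℕ, βs ≤ lad k) ∧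
      ∀ β : ℝ, 0 ≤ β → ∀ δ : ℝ, 0 < δ → δ ≤ Δβ → (βs ≤ β + δ ∨ ∃ k : ℕ, β + δ = lad k) →
      ∀ S : ℕ, L₀ β ≤ S → ∀ m K : ℝ, 0 < m → m ≤ 1 → 2 ≤ K →
        (∀ (A B : YMSpecies G) (a b : ℝ) (w : ℕ), (∀ U, |A.F U| ≤ a) → (∀ U, |B.F U| ≤ b) →
          (∀ e ∈ A.supp, |e.1 0| ≤ (w : ℤ)) → (∀ e ∈ B.supp, |e.1 0| ≤ (w : ℤ)) →
          ∀ n : ℕ, n ≤ S →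
            |latticeConnectedCorr r.ρ β (2 * S + 1) A.F B.F n| ≤
              K * a * b * Real.exp (m * (2 * w)) * Real.exp (-(m * n))) →
        (∀ (A B : YMSpecies G) (a b : ℝ) (w : ℕ), (∀ U, |A.F U| ≤ a) → (∀ U, |B.F U| ≤ b) →
          (∀ e ∈ A.supp, |e.1 0| ≤ (w : ℤ)) → (∀ e ∈ B.supp, |e.1 0| ≤ (w : ℤ)) →
          ∀ n : ℕ, n ≤ 2 * S →
            |latticeConnectedCorr r.ρ (β + δ) (2 * (2 * S) + 1) A.F B.F n| ≤
              c * K * a * b * Real.exp (θ * m * (2 * w)) * Real.exp (-(θ * m * n))) ∧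
        (∀ (A B : YMSpecies G) (a b : ℝ) (w : ℕ), (∀ U, |A.F U| ≤ a) → (∀ U, |B.F U| ≤ b) →
          (∀ e ∈ A.supp, |e.1 0| ≤ (w : ℤ)) → (∀ e ∈ B.supp, |e.1 0| ≤ (w : ℤ)) →
          ∀ n : ℕ, n ≤ 2 * S + 1 →
            |latticeConnectedCorr r.ρ (β + δ) (2 * (2 * S + 1) + 1) A.F B.F n| ≤
              c * K * a * b * Real.exp (θ * m * (2 * w)) * Real.exp (-(θ * m * n)))) →
    (∀ (S : ℕ) (A B : YMSpecies G) (a b : ℝ) (w : ℕ), (∀ U, |A.F U| ≤ a) → (∀ U, |B.F U| ≤ b) →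
      (∀ e ∈ A.supp, |e.1 0| ≤ (w : ℤ)) → (∀ e ∈ B.supp, |e.1 0| ≤ (w : ℤ)) →
      ∀ n : ℕ, n ≤ S →
        |latticeConnectedCorr r.ρ 0 (2 * S + 1) A.F B.F n| ≤
          2 * a * b * Real.exp (1 * (2 * w)) * Real.exp (-(1 * n))) →
    ∃ β₁ : ℝ, ∀ β : ℝ, β₁ ≤ β → ∃ (m K : ℝ) (S₀ : ℕ), 0 < m ∧ m ≤ 1 ∧ 2 ≤ K ∧ ∀ S : ℕ, S₀ ≤ S →
      ∀ (A B : YMSpecies G) (a b : ℝ) (w : ℕ), (∀ U, |A.F U| ≤ a) → (∀ U, |B.F U| ≤ b) →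
        (∀ e ∈ A.supp, |e.1 0| ≤ (w : ℤ)) → (∀ e ∈ B.supp, |e.1 0| ≤ (w : ℤ)) →
        ∀ n : ℕ, n ≤ S →
          |latticeConnectedCorr r.ρ β (2 * S + 1) A.F B.F n| ≤
            K * a * b * Real.exp (m * (2 * w)) * Real.exp (-(m * n)) := by
  intro G _ _ _ _ _ _ r hH hA
  obtain ⟨Δβ, θ, c, βs, L₀, lad, hΔ, hθ, hθ1, hc, h0, hlad, ⟨k₀, hk₀⟩, hstep⟩ := hH
  exact ⟨lad k₀, free_climb (L₀ := L₀)
    (P := fun β S m K => ∀ (A B : YMSpecies G) (a b : ℝ) (w : ℕ), (∀ U, |A.F U| ≤ a) →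
      (∀ U, |B.F U| ≤ b) → (∀ e ∈ A.supp, |e.1 0| ≤ (w : ℤ)) →
      (∀ e ∈ B.supp, |e.1 0| ≤ (w : ℤ)) → ∀ n : ℕ, n ≤ S →
        |latticeConnectedCorr r.ρ β (2 * S + 1) A.F B.F n| ≤
          K * a * b * Real.exp (m * (2 * w)) * Real.exp (-(m * n)))
    hΔ hθ hθ1 hc h0 hlad hstep hA hk₀⟩

end Summit.QuantumFields.YangMills.Theorems.LatticeGapLargeBeta.AfStaircase

end
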